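import Summits.HodgeConjecture.HodgeConjecture.Theorems.F0P3KeysLabelledPair                       -- ★ p833040 `labelledPair_of_reducible` (Casselman §7.1 over N1∕N2∕N3)
import Summits.HodgeConjecture.HodgeConjecture.Theorems.F0P3U3ConstituentEmbedsOfJacquet            -- ★ N2 from N1
import Summits.HodgeConjecture.HodgeConjecture.Theorems.F0P3U3PrincipalSeriesJacquetFiltrationHolds  -- ★ N1 hypothesis-free
import Summits.HodgeConjecture.HodgeConjecture.Theorems.F0P3U3LengthLeTwoOfEmbeds                    -- ★ N3 from N1∕N2; `isSmooth_cmPrincipalSeries`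
import Summits.HodgeConjecture.HodgeConjecture.Theorems.F0P3JacquetEmbeddingDichotomy                -- ★ D1 `exists_injective_intertwiningMap_cmPrincipalSeries`
import Summits.HodgeConjecture.HodgeConjecture.Theorems.F0P3bPrincipalSeriesTrace                     -- ★ `exists_ne_bot_ne_top_of_isConstituentOf_ne`
import Literature.NumberTheory.Automorphic.U3PrincipalSeriesJacquetFiltrationUnfold                   -- ★ `finiteDimensional_finrank_eq_two_of_U3PrincipalSeriesJacquetFiltration`
import Literature.NumberTheory.Automorphic.JacquetModuleExactProofs                                   -- ★ `jacquetMap_injective`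
import Literature.NumberTheory.Automorphic.UnitaryGroupUnipotentLimitCompactOpen                      -- ★ `isLimitOfCompactOpen_cmBorelTriple_N`
import Literature.NumberTheory.Automorphic.JacquetRayExponents                                        -- ★ `jacquetModule_apply_eq_smul_of_normalizedJacquet`
import Literature.NumberTheory.Rogawski1990.SemilocalQuadraticCharExtension                           -- ★ `isQuadraticCharExtension_semilocalComponent_of_baseChange_eq`
import Literature.NumberTheory.Rogawski1990.CMLocalAPacketMembers                                     -- ★ `KeysCaseTwoLabels`, `Gqs`
import Literature.NumberTheory.Automorphic.TorusCharacterLocalComponents                              -- ★ `continuous_semilocalComponent`, `continuous_torusLocalComponent`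
import Mathlib.LinearAlgebra.Trace
import HarnessLib

/-!
# F0 · P3c · line LH6 «StCharTS» — brick «JQLINE» of organ (S-i): the JACQUET MODULES on the (S-i) road — (i) a representation whose normalised Jacquet
# module is the character `χ` has the UNNORMALISED torus action `δ_B^{1/2}χ` on a LINE; (ii) every irreducible smooth class of `U(Φ₃)(L⁺_v)` has Jacquet
# module of dimension `≤ 2`; (iii) at the head's tokens, the two constituents of `i_G(χ_ξ)` (= Keys' labels as an unordered pair) have Jacquet characters
# `χ_ξ` and `wχ_ξ`

Cell `pub/hodgecm-mathlib`, crux H413 = `stmt-HodgeConjecture-24833` (lane `--supports … --as helper`), route HCCMUnconditional; seat LH6-p02 (g0), organ (S-i)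
`stub_StNoncuspidalMember` of the LH6 pay-down skeleton (v2 3bd6ede806aaa044 :297, ⊢ `aX π2 = 1` on `Gqs L v`).  THEOREMS ONLY, sorry-free, every input ★.
HONEST LABEL: HC_CM is proved only modulo the printed citations (2 remaining named inputs hLiu418 24832, h413 24833) until rung 0 closes; nothing here pays a
letter.  ROLE on the (S-i) road [Rogawski1990, proof of L. 12.7.3 p. 195: «by [BZ 2.9] … `π_N = δ^{1/2}φ` … linear independence of characters of `M`»]: the shell
identity (★ R2d) reads each class through `tr(π_N(b) | [V^K])`; §1 turns the labelled constituents' Jacquet data (★ `F0P3KeysLabelledPair`: `r ≃ ℂ_χ`) into those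
traces (`δ_B^{1/2}(b)·χ(b)` times a dimension `≤ 1`), §2 bounds the unknown members' Jacquet modules by `2` (so ★ «TMULT» p848271 applies), §3 delivers the labelled
pair at the head's tokens with its two characters `χ_ξ = cmXiTorusChar …` and `wχ_ξ = cmWeylTorusCharPair …`, hypothesis-free (N1∕N2∕N3 ★, reducibility from Keys'
labels).

## References
* [Rogawski1990] J. D. Rogawski, Ann. of Math. Stud. 123 (1990): §12.2 (2) pp. 173–174; §12.7 proof of Lemma 12.7.3 p. 195.
* [Casselman1995] W. Casselman, *Introduction to the theory of admissible representations of p-adic reductive groups* (1995): §3.3 Thm. 3.3.1, §4.4, L. 7.1.1, Cor. 7.1.2.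
* [BernsteinZelevinsky1977] I. N. Bernstein, A. V. Zelevinsky, Ann. Sci. ÉNS 10 (1977): §2.3 (normalised Jacquet functor), Thm. 2.9.
-/

set_option autoImplicit false
-- the mandated namespace has the single-problem summit's repeated segment (`HodgeConjecture.HodgeConjecture`)
set_option linter.dupNamespace false

noncomputable section

open Module NumberField IsDedekindDomain MeasureTheory
open scoped Matrix

open Literature.NumberTheory Literature.NumberTheory.Automorphic Literature.NumberTheory.Automorphic.UnitaryGroup
open Literature.NumberTheory.GaloisRepresentations
open Literature.NumberTheory.Rogawski1990

namespace Summit.HodgeConjecture.HodgeConjecture.Cruxes.H413.F0P3cStCharTSJacquetLine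

/-! ## §1 Generic: normalised Jacquet module `≃ ℂ_χ` ⇒ the unnormalised torus action is `δ_P^{1/2}χ` on a line -/

section Generic

variable {G V : Type*} [Group G] [TopologicalSpace G] [IsTopologicalGroup G] [AddCommGroup V] [Module ℂ V] {ρ : Representation ℂ G V}

/-- If `r_P(ρ) ≃ ℂ_χ` (an equivalence of `M`-representations), the normalised Jacquet action is the scalar `χ(m)`. [cite: BernsteinZelevinsky1977, §2.3] -/
theorem normalizedJacquet_apply_of_equiv_twist (t : ParabolicTriple G) [LocallyCompactSpace ↥t.P] {χ : ↥t.M →* ℂˣ}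
    (e : (ρ.normalizedJacquet t).Equiv ((Representation.trivial ℂ ↥t.M ℂ).twist χ)) (m : ↥t.M) (w : (t.restrict ρ).Coinvariants) :
    ρ.normalizedJacquet t m w = ((χ m : ℂˣ) : ℂ) • w := by
  apply e.toLinearEquiv.injective
  change e.toIntertwiningMap (ρ.normalizedJacquet t m w) = e.toIntertwiningMap (((χ m : ℂˣ) : ℂ) • w)
  rw [e.toIntertwiningMap.isIntertwining _ _ m w, map_smul, Representation.twist_apply, Representation.trivial_apply]

/-- **`r_P(ρ) ≃ ℂ_χ` ⇒ `π_N(m) w = δ_P(m)^{1/2} χ(m) · w`** on the Jacquet module (★ `jacquetModule_apply_eq_smul_of_normalizedJacquet`).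
[cite: BernsteinZelevinsky1977, §2.3] [cite: Casselman1995, §4.4 p. 45] -/
theorem jacquetModule_apply_of_equiv_twist (t : ParabolicTriple G) [LocallyCompactSpace ↥t.P] {χ : ↥t.M →* ℂˣ}
    (e : (ρ.normalizedJacquet t).Equiv ((Representation.trivial ℂ ↥t.M ℂ).twist χ)) (m : ↥t.M) (w : (t.restrict ρ).Coinvariants) :
    ρ.jacquetModule t m w = (((rootDeltaChar t.P (Subgroup.inclusion t.M_le m) : ℂˣ) : ℂ) * ((χ m : ℂˣ) : ℂ)) • w :=
  Representation.jacquetModule_apply_eq_smul_of_normalizedJacquet t (fun m' => normalizedJacquet_apply_of_equiv_twist t e m' w) m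

/-- `r_P(ρ) ≃ ℂ_χ` ⇒ the Jacquet module is ONE-dimensional. [cite: Casselman1995, L. 7.1.1] -/
theorem finrank_coinvariants_eq_one_of_equiv_twist (t : ParabolicTriple G) [LocallyCompactSpace ↥t.P] {χ : ↥t.M →* ℂˣ}
    (e : (ρ.normalizedJacquet t).Equiv ((Representation.trivial ℂ ↥t.M ℂ).twist χ)) :
    finrank ℂ (t.restrict ρ).Coinvariants = 1 := by
  rw [e.toLinearEquiv.finrank_eq, Module.finrank_self]

/-- **The trace of `π_N(m)` on any `π_N`-stable subspace `W` of a Jacquet LINE `r_P(ρ) ≃ ℂ_χ` is `(dim W) · δ_P(m)^{1/2} χ(m)`** (`dim W ∈ {0, 1}`) — the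
form in which ★ R2d `smoothTrace_indicator_shell_eq` reads the character of `ρ` on the shells `K b K` (`W = [V^K]`). [cite: Casselman1995, §4.4 p. 45; L. 7.1.1] -/
theorem trace_jacquetModule_restrict_of_equiv_twist (t : ParabolicTriple G) [LocallyCompactSpace ↥t.P] {χ : ↥t.M →* ℂˣ}
    (e : (ρ.normalizedJacquet t).Equiv ((Representation.trivial ℂ ↥t.M ℂ).twist χ)) (m : ↥t.M)
    (W : Submodule ℂ (t.restrict ρ).Coinvariants) (hW : ∀ w ∈ W, ρ.jacquetModule t m w ∈ W) :
    LinearMap.trace ℂ W ((ρ.jacquetModule t m).restrict hW) =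
      (finrank ℂ W : ℂ) * ((((rootDeltaChar t.P (Subgroup.inclusion t.M_le m) : ℂˣ) : ℂ) * ((χ m : ℂˣ) : ℂ))) := by
  haveI : FiniteDimensional ℂ (t.restrict ρ).Coinvariants := LinearEquiv.finiteDimensional e.toLinearEquiv.symm
  have hsc : (ρ.jacquetModule t m).restrict hW =
      ((((rootDeltaChar t.P (Subgroup.inclusion t.M_le m) : ℂˣ) : ℂ) * ((χ m : ℂˣ) : ℂ))) • (LinearMap.id : W →ₗ[ℂ] W) := by
    ext w
    rw [LinearMap.coe_restrict_apply, jacquetModule_apply_of_equiv_twist t e m, LinearMap.smul_apply, LinearMap.id_apply, Submodule.coe_smul]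
  rw [hsc, map_smul, LinearMap.trace_id, smul_eq_mul, mul_comm]

end Generic

/-! ## §2 `U(Φ₃)(L⁺_v)`: the Jacquet module of an irreducible smooth class has dimension `≤ 2` -/

section U3

variable (L : Type) [Field L] [NumberField L] [IsCMField L] (v : HeightOneSpectrum (𝓞 ↥(maximalRealSubfield L)))

set_option synthInstance.maxHeartbeats 400000 in
set_option maxHeartbeats 4000000 in
/-- **«JDIM2»: `dim r_B(π) ≤ 2` for every irreducible smooth `π` of `U(Φ₃)(L⁺_v)`** (non-split `v`): if `r_B(π) ≠ 0`, `π ↪ i_G(χ₁, χ₂)` with continuous `χ₁, χ₂` (★ D1), the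
Jacquet functor preserves the injection (★ `jacquetMap_injective`), and `r_B i_G(χ)` is `2`-dimensional (★ N1).  Same proof as ★
`F0P2oN7OfCasselmanCriterion.finiteDimensional_coinvariants_of_irreducible`, keeping the dimension. [cite: Casselman1995, Thm. 3.3.1; L. 7.1.1] [cite: BernsteinZelevinsky1977, §2.3] -/
theorem finrank_coinvariants_le_two (hns : ∀ w : PlacesOver L v, IsCMField.complexConj L • w.1 = w.1) (r : SmoothIrrep (Gqs L v)) :
    FiniteDimensional ℂ ((cmBorelTriple L 3 v).restrict r.ρ).Coinvariants ∧ finrank ℂ ((cmBorelTriple L 3 v).restrict r.ρ).Coinvariants ≤ 2 := by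
  haveI := locallyCompactSpace_cmBorelU L 3 v
  by_cases hsub : Subsingleton ((cmBorelTriple L 3 v).restrict r.ρ).Coinvariants
  · haveI := hsub
    exact ⟨inferInstance, by rw [Module.finrank_zero_of_subsingleton]; exact Nat.zero_le 2⟩
  · have hD := F0P3JacquetEmbeddingDichotomy.exists_injective_intertwiningMap_cmPrincipalSeries L v r hsub
    refine hD.elim fun χ₁ h₁ => h₁.elim fun χ₂ h₂ => h₂.2.2.elim fun e he => ?_
    have key := finiteDimensional_finrank_eq_two_of_U3PrincipalSeriesJacquetFiltration L
      (F0P3U3PrincipalSeriesJacquetFiltrationHolds.U3PrincipalSeriesJacquetFiltration_holds L) v hns χ₁ χ₂ h₂.1 h₂.2.1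
    haveI := key.1
    have hinj := Representation.jacquetMap_injective (cmBorelTriple L 3 v) (isLimitOfCompactOpen_cmBorelTriple_N L 3 v)
      (F0P3U3LengthLeTwoOfEmbeds.isSmooth_cmPrincipalSeries L v (cmTorusCharPair L v χ₁ χ₂)) e he
    haveI : FiniteDimensional ℂ ((cmBorelTriple L 3 v).restrict r.ρ).Coinvariants :=
      Module.Finite.of_injective (Representation.jacquetMap (cmBorelTriple L 3 v) e).toLinearMap hinj
    refine ⟨inferInstance, ?_⟩
    calc finrank ℂ ((cmBorelTriple L 3 v).restrict r.ρ).Coinvariants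
        ≤ finrank ℂ ((cmBorelTriple L 3 v).restrict (cmPrincipalSeries L 3 v (cmTorusCharPair L v χ₁ χ₂))).Coinvariants :=
          LinearMap.finrank_le_finrank_of_injective hinj
      _ = 2 := key.2

/-! ## §3 `U(Φ₃)(L⁺_v)` at the head's tokens: the labelled pair of `i_G(χ_ξ)` with its Jacquet characters, hypothesis-free -/

set_option synthInstance.maxHeartbeats 400000 in
set_option maxHeartbeats 4000000 in
/-- **«KEYS-JQ»: the two constituents of `i_G(χ_{ξ,v})` carry the Jacquet characters `χ_ξ` and `wχ_ξ`** — at a non-split `v`, for the Hecke character `μ` of the head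
(`μ|𝔸_{L⁺} = ω`) and `ξ`, given Keys' labels `(π², πⁿ)` (★ `KeysCaseTwoLabels`, which makes `i_G(χ_ξ)` reducible): there are classes `πs′ ≠ πn′` with
`{πⁿ, π²} = {πn′, πs′}` (same constituent set) and representatives whose normalised Jacquet modules are `≃ ℂ_{χ_ξ}` resp. `≃ ℂ_{wχ_ξ}`
(`χ_ξ = cmXiTorusChar L v μ_v η_v ψ_v`, `wχ_ξ = cmWeylTorusCharPair L v χ_{ξ,1} ψ_v`).  ★ `labelledPair_of_reducible` at the ★ N1∕N2∕N3 `_holds` and the head's side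
conditions (★ `isQuadraticCharExtension_semilocalComponent_of_baseChange_eq`, continuity ★).  Which of `πs′, πn′` is `π²` is NOT asserted (and not needed on the
(S-i) road). [cite: Rogawski1990, §12.2 (2) pp. 173–174; §12.7 proof of Lemma 12.7.3 p. 195] [cite: Casselman1995, L. 7.1.1 (a), Cor. 7.1.2, Cor. 6.3.9 (b)] -/
theorem labelledPair_xi (hns : ∀ w : PlacesOver L v, IsCMField.complexConj L • w.1 = w.1) (μ : HeckeCharacter L)
    (hμω : ∀ x : Literature.NumberTheory.GaloisRepresentations.ideleGroup ↥(maximalRealSubfield L),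
      μ (AdeleRing.ideleBaseChange (↥(maximalRealSubfield L)) L x) = quadraticHeckeCharCM L x)
    (ξ : OneDimAutRepH L) {π2 πn : IrrClass (Gqs L v)}
    (hK : KeysCaseTwoLabels L v (μ.semilocalComponent L v) (torusLocalComponent L (IsCMField.complexConj L) v ξ.η)
      (torusLocalComponent L (IsCMField.complexConj L) v ξ.ψ) π2 πn) :
    ∃ πs' πn' : IrrClass (Gqs L v), πs' ≠ πn' ∧
      (∀ c : IrrClass (Gqs L v), (c = πn ∨ c = π2) ↔ (c = πn' ∨ c = πs')) ∧
      (haveI := locallyCompactSpace_cmBorelU L 3 v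
       ∃ r : SmoothIrrep (Gqs L v), IrrClass.mk r = πs' ∧
        Nonempty ((r.ρ.normalizedJacquet (cmBorelTriple L 3 v)).Equiv
          ((Representation.trivial ℂ ↥(torusU (conjLocal L (IsCMField.complexConj L) v) (cmLocalForm L 3 v)) ℂ).twist
            (cmXiTorusChar L v (μ.semilocalComponent L v) (torusLocalComponent L (IsCMField.complexConj L) v ξ.η)
              (torusLocalComponent L (IsCMField.complexConj L) v ξ.ψ))))) ∧
      (haveI := locallyCompactSpace_cmBorelU L 3 v
       ∃ r : SmoothIrrep (Gqs L v), IrrClass.mk r = πn' ∧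
        Nonempty ((r.ρ.normalizedJacquet (cmBorelTriple L 3 v)).Equiv
          ((Representation.trivial ℂ ↥(torusU (conjLocal L (IsCMField.complexConj L) v) (cmLocalForm L 3 v)) ℂ).twist
            (cmWeylTorusCharPair L v
              ((torusLocalComponent L (IsCMField.complexConj L) v ξ.η).comp
                  (quotConj (conjLocal L (IsCMField.complexConj L) v) (conjLocal_conjLocal_cm L v)) * μ.semilocalComponent L v *
                halfModulusChar (LocalRing L v)) (torusLocalComponent L (IsCMField.complexConj L) v ξ.ψ))))) := by
  haveI := locallyCompactSpace_cmBorelU L 3 v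
  -- the three letters, hypothesis-free
  have hN1 : U3PrincipalSeriesJacquetFiltration L := F0P3U3PrincipalSeriesJacquetFiltrationHolds.U3PrincipalSeriesJacquetFiltration_holds L
  have hN2 : U3PrincipalSeriesConstituentEmbeds L := F0P3U3ConstituentEmbedsOfJacquet.u3PrincipalSeriesConstituentEmbeds_of_jacquetFiltration L hN1
  have hN3 : U3PrincipalSeriesLengthLeTwo L := F0P3U3LengthLeTwoOfEmbeds.u3PrincipalSeriesLengthLeTwo_of_embeds L hN1 hN2
  -- reducibility of `i_G(χ_ξ)`: two distinct constituents (Keys' labels)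
  have hred := F0P3bPrincipalSeriesTrace.exists_ne_bot_ne_top_of_isConstituentOf_ne ((hK.2 πn).2 (Or.inl rfl)) ((hK.2 π2).2 (Or.inr rfl)) hK.1.symm
  have H := F0P3KeysLabelledPair.labelledPair_of_reducible L v hN1 hN2 hN3 hns (μ.semilocalComponent L v)
    (torusLocalComponent L (IsCMField.complexConj L) v ξ.η) (torusLocalComponent L (IsCMField.complexConj L) v ξ.ψ)
    (isQuadraticCharExtension_semilocalComponent_of_baseChange_eq μ hμω v)
    (Units.continuous_val.comp (continuous_semilocalComponent L μ)) (continuous_torusLocalComponent L (IsCMField.complexConj L) ξ.η)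
    (continuous_torusLocalComponent L (IsCMField.complexConj L) ξ.ψ) hred
  rcases H with ⟨πs', πn', hne, hJH, hs, hn⟩
  refine ⟨πs', πn', hne, fun c => ?_, hs, hn⟩
  rw [← hK.2 c, hJH c]

end U3

end Summit.HodgeConjecture.HodgeConjecture.Cruxes.H413.F0P3cStCharTSJacquetLine

end
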